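import Mathlib.Combinatorics.SimpleGraph.Walk.Maps
import Mathlib.Combinatorics.SimpleGraph.Paths
import Literature.Probability.RandomPlanarGeometry.SAWRestrictionCovariance
import Summits.CriticalPhenomena.SAWScalingLimit.Theorems.SAWRenewalTightnessSubseqIdentificationRestrictionPassage
import Summits.CriticalPhenomena.SAWScalingLimit.Theorems.SubseqIdentification.Negative.Necessity

/-!
# `stub_latticeRestriction`: the exact lattice restriction identity at a fixed mesh

Stub S1 of the line `birth` for the crux `RestrictionOfLimit` (stmt-CriticalPhenomena-0773, shared by
the routes SAWConePseudogroup / SAWConfRestriction / SAWBrownianDomination / SAWTowerCount /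
SAWTensorRG).

If the discrete sub-domain `Ω'_δ = discreteDomainGraph Ω' δ` is a subgraph of `Ω_δ`, then for every
set `T` of curve classes

  `P_{Ω',δ}(curve ∈ T) · P_{Ω,δ}(S) = P_{Ω,δ}({curve ∈ T} ∩ S)`,

where `S` is the set of SAWs of `Ω_δ` from `a` to `b` all of whose edges are edges of `Ω'_δ`
(Lawler–Schramm–Werner, *On the scaling limit of planar self-avoiding walk*, arXiv:math/0204277,
§3.4.5 p. 14: "the measures `μ_saw(z,w;D,N)` satisfy the restriction property", made exact at the
lattice level).

Proof. Under the graph inclusion the edge-confinement event `S` coincides with the support-confinement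
event `{γ | ∃ γ' : SAW(Ω'_δ; a, b), γ'.support = γ.support}` (`SimpleGraph.Walk.transfer` /
`Walk.mapLe` preserve supports, paths and edges), and every `Ω'_δ`-walk is an `Ω_δ`-walk with the
same support (nesting). If the law of `Ω'_δ` is a probability measure, the identity is
`SAW.law_confined_inter_preimage_curve_eq` up to commuting the product and the intersection. Otherwise
the law of `Ω'_δ` is the zero measure (`isProbabilityMeasure_law_or_eq_zero`), the left side vanishes,
and so does the right side: `P_{Ω,δ}(S) = Z⁻¹ Z'` (`SAW.law_setOf_exists_support_eq_eq`) with
`Z'⁻¹ Z' = 0`, i.e. `Z' = 0` or `Z' = ∞`, and in the latter case `Z = ∞` since `Z' ≤ Z`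
(`SAW.weight_univ_le_weight_univ`).
-/

noncomputable section

open MeasureTheory Filter Topology Set Literature.Probability.RandomPlanarGeometry
  Literature.Probability.LatticeModels
open scoped ENNReal

namespace Summit.CriticalPhenomena.SAWScalingLimit.Theorems.RestrictionOfLimit.Birth

/-- **The two confinement events coincide.** If `Ω'_δ ≤ Ω_δ` as graphs, a SAW of `Ω_δ` from `a` to
`b` uses only edges of `Ω'_δ` iff it has the support of a SAW of `Ω'_δ` from `a` to `b`: transfer
along the edge condition (`SimpleGraph.Walk.transfer`, `IsPath.transfer`, `support_transfer`) one
way; the other way the `Ω_δ`-copy `γ'.walk.mapLe h` has the same support, hence IS `γ.walk`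
(`support_injective`), and its edges are those of `γ'` (`edges_mapLe_eq_edges`), which lie in
`Ω'_δ` (LSW04 arXiv:math/0204277 §3.4.5 p. 14, "walks that stay in `N D'` in the appropriate
sense"). -/
theorem setOf_forall_edges_mem_eq_setOf_exists_support_eq {Ω Ω' : Set ℂ} {δ : ℝ} {a b : Site 2}
    (h : discreteDomainGraph Ω' δ ≤ discreteDomainGraph Ω δ) :
    {γ : SAW.DomainSAW Ω δ a b | ∀ e ∈ γ.walk.edges, e ∈ (discreteDomainGraph Ω' δ).edgeSet} =
      {γ : SAW.DomainSAW Ω δ a b |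
        ∃ γ' : SAW.DomainSAW Ω' δ a b, γ'.walk.support = γ.walk.support} := by
  ext γ
  constructor
  · intro hγ
    exact ⟨⟨γ.walk.transfer (discreteDomainGraph Ω' δ) hγ, γ.isPath.transfer hγ⟩,
      γ.walk.support_transfer hγ⟩
  · rintro ⟨γ', hγ'⟩ e he
    have hw : γ.walk = γ'.walk.mapLe h :=
      SimpleGraph.Walk.support_injective
        (hγ'.symm.trans (SimpleGraph.Walk.support_mapLe_eq_support h γ'.walk).symm)
    rw [hw, SimpleGraph.Walk.edges_mapLe_eq_edges] at he
    exact γ'.walk.edges_subset_edgeSet he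

/-- **Nesting from the graph inclusion.** If `Ω'_δ ≤ Ω_δ` as graphs, every SAW of `Ω'_δ` from `a` to
`b` is, with the same support, a SAW of `Ω_δ` (`Walk.mapLe`, `IsPath.mapLe`,
`support_mapLe_eq_support`); this is the hypothesis of the tree's lattice restriction identities
(LSW04 arXiv:math/0204277 §3.4.5 p. 14). -/
theorem forall_exists_support_eq_of_le {Ω Ω' : Set ℂ} {δ : ℝ} {a b : Site 2}
    (h : discreteDomainGraph Ω' δ ≤ discreteDomainGraph Ω δ) :
    ∀ γ' : SAW.DomainSAW Ω' δ a b, ∃ γ : SAW.DomainSAW Ω δ a b,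
      γ.walk.support = γ'.walk.support :=
  fun γ' => ⟨⟨γ'.walk.mapLe h, (SimpleGraph.Walk.isPath_mapLe h).2 γ'.isPath⟩,
    SimpleGraph.Walk.support_mapLe_eq_support h _⟩

/-- **S1 — the exact lattice restriction identity at fixed mesh** (LSW04 arXiv:math/0204277 p. 14
§3.4.5, made exact). If `Ω'_δ = discreteDomainGraph Ω' δ` is a subgraph of `Ω_δ`, then for every
event `T` of curve classes `P_{Ω',δ}(curve ∈ T) · P_{Ω,δ}(S) = P_{Ω,δ}({curve ∈ T} ∩ S)`, where `S`
is the set of SAWs of `Ω_δ` from `a` to `b` all of whose edges are edges of `Ω'_δ`. The edge event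
is the support-confinement event (`setOf_forall_edges_mem_eq_setOf_exists_support_eq`); in the
probability case this is `SAW.law_confined_inter_preimage_curve_eq`, and in the junk case
`law Ω' = 0` both sides vanish (`P_{Ω,δ}(S) = Z⁻¹ Z'` with `Z' = 0`, or `Z' = ∞` whence `Z = ∞`).
No positivity of the mesh, boundedness of the domain or measurability of `T` is needed. -/
theorem stub_latticeRestriction :
    ∀ (Ω Ω' : Set ℂ) (δ : ℝ) (a b : Site 2),
      discreteDomainGraph Ω' δ ≤ discreteDomainGraph Ω δ →
        ∀ T : Set (CurveClass ℂ),
          SAW.law Ω' δ a b ((fun γ : SAW.DomainSAW Ω' δ a b => γ.curve) ⁻¹' T) *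
              SAW.law Ω δ a b
                {γ : SAW.DomainSAW Ω δ a b | ∀ e ∈ γ.walk.edges, e ∈ (discreteDomainGraph Ω' δ).edgeSet} =
            SAW.law Ω δ a b
              (((fun γ : SAW.DomainSAW Ω δ a b => γ.curve) ⁻¹' T) ∩
                {γ : SAW.DomainSAW Ω δ a b |
                  ∀ e ∈ γ.walk.edges, e ∈ (discreteDomainGraph Ω' δ).edgeSet}) := by
  intro Ω Ω' δ a b h T
  have hN := forall_exists_support_eq_of_le (a := a) (b := b) h
  rw [setOf_forall_edges_mem_eq_setOf_exists_support_eq h]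
  rcases SubseqIdentification.Negative.isProbabilityMeasure_law_or_eq_zero Ω' δ a b with hP | h0
  · -- genuine probability law of the small domain: the tree's exact identity
    haveI := hP
    rw [Set.inter_comm, SAW.law_confined_inter_preimage_curve_eq hN T, mul_comm]
  · -- junk case: the law of the small domain is the zero measure, both sides vanish
    rw [h0, Measure.coe_zero, Pi.zero_apply, zero_mul]
    symm
    refine measure_mono_null Set.inter_subset_right ?_
    rw [SAW.law_setOf_exists_support_eq_eq hN]
    have hZ' : (SAW.weight Ω' δ a b univ)⁻¹ * SAW.weight Ω' δ a b univ = 0 := by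
      rw [← SAW.law_apply_eq_inv_mul_weight, h0, Measure.coe_zero, Pi.zero_apply]
    rcases mul_eq_zero.1 hZ' with hinv | hzero
    · -- `Z' = ∞`, hence `Z = ∞` and `Z⁻¹ = 0`
      have htop : SAW.weight Ω' δ a b univ = ∞ := ENNReal.inv_eq_zero.1 hinv
      have hZ : SAW.weight Ω δ a b univ = ∞ :=
        top_unique (htop ▸ SAW.weight_univ_le_weight_univ hN)
      rw [hZ, ENNReal.inv_top, zero_mul]
    · rw [hzero, mul_zero]

end Summit.CriticalPhenomena.SAWScalingLimit.Theorems.RestrictionOfLimit.Birth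

end
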